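import Literature.Geometry.Riemannian.ExpMapCovDerivLift
import Literature.Geometry.Riemannian.ExpMapJacobiField
import Literature.Geometry.Lorentzian.GeodesicSpeed
import Literature.Geometry.Lorentzian.LeviCivitaCurvature
import HarnessLib

/-!
# The second variation of the energy density through geodesic variations
(Lee 2018, Thm. 6.3 / Thm. 10.22 — the pointwise computation behind the variation formulas)

Layer 6c of the programme for `Literature.Geometry.Riemannian.lee_expMap_injectivityDomain`
(Lee 2018, Thm. 10.34 / Thm. 10.26). For a smooth pseudo-Riemannian metric `g` (Levi-Civita
connection `∇`, curvature `R`) and a `C^∞` two-parameter map `x(t, σ)` ALL OF WHOSE `σ`-CURVES ARE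
GEODESICS (as for `x(t, σ) = exp_{γ(t)}(σ X(t))`), with `T = ∂_t x`, `S = ∂_σ x`:

* `hasDerivAt_half_val_velocity` — `∂_σ ½ g(T, T) = g(D_t S, T)` (metric compatibility and the
  symmetry lemma `D_σ T = D_t S`);
* `hasDerivAt_val_covariantDerivAlong_velocity` — `∂_σ g(D_t S, T) = g(R(S, T) S, T) + g(D_t S, D_t S)`
  (metric compatibility, `D_σ T = D_t S`, and the curvature identity
  `D_t D_σ S − D_σ D_t S = R(T, S) S` with `D_σ S = 0`).

At `σ = 0` these are the integrands of the first and second variation formulas (Lee 2018,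
Thm. 6.3 and Thm. 10.22: `d²/ds² = ∫ |D_t V|² − Rm(V, γ', γ', V)` for a variation whose transverse
curves are geodesics, so that the acceleration term vanishes), here for the ENERGY density
`½|∂_t x|²` and in pointwise form; no integration is performed. No definitions, no named facts
(D-0026).

## References

* J. M. Lee, *Introduction to Riemannian Manifolds*, 2nd ed. (2018), Ch. 6 (first variation),
  Ch. 10 (second variation formula, Thm. 10.26). [LeeRiemannianManifolds2018]
* B. O'Neill, *Semi-Riemannian geometry* (1983), Ch. 4, Prop. 44; Ch. 10, §1. [ONeill1983]
-/

noncomputable section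

open Bundle Set Filter Function
open scoped Manifold ContDiff Topology

namespace Literature.Geometry.Riemannian

open Literature.Geometry.Lorentzian
open Literature.Geometry.Lorentzian.PseudoRiemannianMetric

variable {E : Type*} [NormedAddCommGroup E] [NormedSpace ℝ E] {H : Type*} [TopologicalSpace H]
  {I : ModelWithCorners ℝ E H} {M : Type*} [TopologicalSpace M] [ChartedSpace H M]
  [IsManifold I ∞ M] {n : ℕ∞ω} [FiniteDimensional ℝ E] [CompleteSpace E]
  (g : PseudoRiemannianMetric I n E (TangentSpace I : M → Type _)) [g.HasLeviCivita]

/-- **First σ-derivative of the energy density**: for a `C^∞` two-parameter map `x(t, σ)` and a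
smooth metric, `∂_σ ½ g(x_t, x_t) = g(D_t x_σ, x_t)` at every `(t, σ)` (metric compatibility,
`hasDerivAt_val_apply_along`, and the symmetry lemma `D_σ x_t = D_t x_σ`,
`covariantDerivAlong_velocity_comm`). Lee 2018, proof of Thm. 6.3 (first variation formula).
[cite: LeeRiemannianManifolds2018, Thm. 6.3 (proof)] -/
theorem hasDerivAt_half_val_velocity (hn : (∞ : ℕ∞ω) ≤ n) {x : ℝ → ℝ → M}
    (hx : ContMDiff (𝓘(ℝ, ℝ).prod 𝓘(ℝ, ℝ)) I ∞ (uncurry x)) (t σ : ℝ) :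
    HasDerivAt (fun σ' ↦ (1 / 2 : ℝ) * g.val (x t σ') (velocity I (fun t' ↦ x t' σ') t)
        (velocity I (fun t' ↦ x t' σ') t))
      (g.val (x t σ) (covariantDerivAlong g.leviCivita (fun t' ↦ x t' σ)
        (fun t' ↦ velocity I (x t') σ) t) (velocity I (fun t' ↦ x t' σ) t)) σ := by
  haveI : Fact (1 ≤ n) := ⟨le_trans (by exact_mod_cast le_top) hn⟩
  have hLC : g.IsLeviCivita g.leviCivita := isLeviCivita_leviCivita_holds (g := g)
  have h2 : (2 : ℕ∞ω) ≤ ∞ := WithTop.coe_le_coe.2 le_top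
  have hx2 : ContMDiffAt (𝓘(ℝ, ℝ).prod 𝓘(ℝ, ℝ)) I 2 (uncurry x) (t, σ) := (hx (t, σ)).of_le h2
  -- the lift of `σ' ↦ x_t(t, σ')` along the `σ`-curve
  have hlift := mdifferentiableAt_lift_velocity_curry_left hx2
  have hprod := g.hasDerivAt_val_apply_along hLC.2 hlift hlift
  -- symmetry: `D_σ x_t = D_t x_σ`
  have hsymm := covariantDerivAlong_velocity_comm g.leviCivita hLC.1 hx2
  rw [← hsymm, g.symm (x t σ) (velocity I (fun t' ↦ x t' σ) t), ← two_mul] at hprod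
  have h := hprod.const_mul (1 / 2 : ℝ)
  have h2 : ∀ G : ℝ, (1 / 2 : ℝ) * (2 * G) = G := fun G ↦ by ring
  rw [h2] at h
  exact h

/-- **Second σ-derivative of the energy density through geodesics**: if moreover every
`σ`-curve `σ ↦ x(t, σ)` is a geodesic, then
`∂_σ g(D_t x_σ, x_t) = g(R(x_σ, x_t) x_σ, x_t) + g(D_t x_σ, D_t x_σ)` at every `(t, σ)`
(metric compatibility; `D_σ x_t = D_t x_σ`; `D_σ D_t x_σ = D_t D_σ x_σ − R(x_t, x_σ) x_σ = R(x_σ, x_t) x_σ`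
since `D_σ x_σ = 0`, `covariantDerivAlong_covariantDerivAlong_sub_eq_curvature`). At `σ = 0` this
is the integrand of the second variation / index form `|D_t V|² − Rm(V, γ', γ', V)` (Lee 2018,
Thm. 10.22, second variation formula, for variations whose transverse curves are geodesics).
[cite: LeeRiemannianManifolds2018, Thm. 10.22 (proof)] -/
theorem hasDerivAt_val_covariantDerivAlong_velocity (hn : (∞ : ℕ∞ω) ≤ n) {x : ℝ → ℝ → M}
    (hx : ContMDiff (𝓘(ℝ, ℝ).prod 𝓘(ℝ, ℝ)) I ∞ (uncurry x))
    (hgeo : ∀ t : ℝ, IsGeodesic g.leviCivita (x t)) (t σ : ℝ) :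
    HasDerivAt (fun σ' ↦ g.val (x t σ') (covariantDerivAlong g.leviCivita (fun t' ↦ x t' σ')
        (fun t' ↦ velocity I (x t') σ') t) (velocity I (fun t' ↦ x t' σ') t))
      (g.val (x t σ) (g.leviCivita.curvature (x t σ) (velocity I (x t) σ)
          (velocity I (fun t' ↦ x t' σ) t) (velocity I (x t) σ)) (velocity I (fun t' ↦ x t' σ) t) +
        g.val (x t σ) (covariantDerivAlong g.leviCivita (fun t' ↦ x t' σ)
          (fun t' ↦ velocity I (x t') σ) t)
          (covariantDerivAlong g.leviCivita (fun t' ↦ x t' σ) (fun t' ↦ velocity I (x t') σ) t)) σ := by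
  haveI : Fact (1 ≤ n) := ⟨le_trans (by exact_mod_cast le_top) hn⟩
  have hLC : g.IsLeviCivita g.leviCivita := isLeviCivita_leviCivita_holds (g := g)
  set cov := g.leviCivita with hcov
  have hcov1 : cov.IsLocallyContMDiff 1 :=
    g.isLocallyContMDiff_leviCivita_holds 1 (le_trans (by exact_mod_cast le_top) hn)
  have hcovI : cov.IsLocallyContMDiff ∞ :=
    g.isLocallyContMDiff_leviCivita_holds ⊤ (le_trans (by exact_mod_cast le_rfl) hn)
  have h2 : (2 : ℕ∞ω) ≤ ∞ := WithTop.coe_le_coe.2 le_top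
  have hx2 : ∀ q : ℝ × ℝ, ContMDiffAt (𝓘(ℝ, ℝ).prod 𝓘(ℝ, ℝ)) I 2 (uncurry x) q :=
    fun q ↦ (hx q).of_le h2
  -- the field `S = x_σ` and its smooth lift
  have hS : ContMDiff (𝓘(ℝ, ℝ).prod 𝓘(ℝ, ℝ)) I.tangent ∞
      (fun q : ℝ × ℝ ↦ (TotalSpace.mk' E (x q.1 q.2) (velocity I (x q.1) q.2) : TangentBundle I M)) := by
    -- apply the joint lift lemma to the flipped map
    have hswap : ContMDiff (𝓘(ℝ, ℝ).prod 𝓘(ℝ, ℝ)) (𝓘(ℝ, ℝ).prod 𝓘(ℝ, ℝ)) ∞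
        (fun q : ℝ × ℝ ↦ ((q.2, q.1) : ℝ × ℝ)) := contMDiff_snd.prodMk contMDiff_fst
    have hx' : ContMDiff (𝓘(ℝ, ℝ).prod 𝓘(ℝ, ℝ)) I ∞ (uncurry fun s t ↦ x t s) := hx.comp hswap
    exact (contMDiff_lift_velocity_uncurry_left hx').comp hswap
  -- the field `D_t S` and its smooth lift
  have hDtS : ContMDiff (𝓘(ℝ, ℝ).prod 𝓘(ℝ, ℝ)) I.tangent ∞
      (fun q : ℝ × ℝ ↦ (TotalSpace.mk' E (x q.1 q.2)
        (covariantDerivAlong cov (fun t' ↦ x t' q.2) (fun t' ↦ velocity I (x t') q.2) q.1) :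
          TangentBundle I M)) :=
    contMDiff_lift_covariantDerivAlong_curry_left (cov := cov) hcovI hx hS
  -- lifts along the `σ`-curve at `t`
  have hline : ContMDiff 𝓘(ℝ, ℝ) (𝓘(ℝ, ℝ).prod 𝓘(ℝ, ℝ)) ∞ (fun σ' : ℝ ↦ ((t, σ') : ℝ × ℝ)) :=
    contMDiff_const.prodMk contMDiff_id
  have hV : MDifferentiableAt 𝓘(ℝ, ℝ) I.tangent
      (fun σ' ↦ (TotalSpace.mk' E (x t σ')
        (covariantDerivAlong cov (fun t' ↦ x t' σ') (fun t' ↦ velocity I (x t') σ') t) :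
          TangentBundle I M)) σ :=
    ((hDtS.comp hline) σ).mdifferentiableAt (by simp)
  have hW : MDifferentiableAt 𝓘(ℝ, ℝ) I.tangent
      (fun σ' ↦ (TotalSpace.mk' E (x t σ') (velocity I (fun t' ↦ x t' σ') t) : TangentBundle I M)) σ :=
    mdifferentiableAt_lift_velocity_curry_left (hx2 (t, σ))
  have hprod := g.hasDerivAt_val_apply_along hLC.2 hV hW
  -- `D_σ x_t = D_t x_σ`
  have hsymm := covariantDerivAlong_velocity_comm cov hLC.1 (hx2 (t, σ))
  -- `D_σ (D_t S) = R(S, T) S`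
  have hcurv := covariantDerivAlong_covariantDerivAlong_sub_eq_curvature (cov := cov) hcov1
    (x := x) (Z := fun t' s' ↦ velocity I (x t') s') (t := t) (s := σ) (hx2 (t, σ))
    ((hS (t, σ)).of_le h2)
  beta_reduce at hcurv
  have hzero : (fun t' ↦ covariantDerivAlong cov (x t') (fun s' ↦ velocity I (x t') s') σ) =
      fun t' ↦ (0 : TangentSpace I (x t' σ)) :=
    funext fun t' ↦ (hgeo t').2 σ (mem_univ σ)
  rw [hzero, covariantDerivAlong_zero_field, zero_sub] at hcurv
  -- `hcurv : - D_σ (D_t S) = R(T, S) S`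
  have hDσ : covariantDerivAlong cov (x t)
      (fun s' ↦ covariantDerivAlong cov (fun t' ↦ x t' s') (fun t' ↦ velocity I (x t') s') t) σ =
      cov.curvature (x t σ) (velocity I (x t) σ) (velocity I (fun t' ↦ x t' σ) t) (velocity I (x t) σ) := by
    rw [CovariantDerivative.curvature_antisymm, ← hcurv, neg_neg]
  rw [hDσ, ← hsymm] at hprod
  exact hprod

end Literature.Geometry.Riemannian
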